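import Literature.NumberTheory.Irrationality.LaiYu2020.AuxiliaryFunction
import Literature.NumberTheory.Irrationality.LaiYu2020.ZeroSetSymmetry
import Literature.NumberTheory.Transcendental.PartialFractions
import HarnessLib

/-!
# Lai–Yu 2020, §2: properties (1), (2) of `R_n(t)` and its partial-fraction expansion — proofs

Topic `Literature/NumberTheory/Irrationality/LaiYu2020`. Companion ("Proofs") file of
`AuxiliaryFunction.lean` (Def. 2.3), for L. Lai, P. Yu, *A note on the number of irrational odd
zeta values*, Compositio Math. **156** (2020) 1699–1717 = arXiv:1911.08458 [LaiYu2020], §2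
(arXiv text p. 5):

> «Since the numerator and denominator of `R_n(t)` have a common factor `∏_{j=0}^{n}(t+j)`, it can be
> rewritten as `R_n(t) = Q_n(t)/∏_{j=0}^{n}(t+j)^s` … Since `deg R_n < 0` (see below), we know that
> `R_n(t)` has a (unique) partial fraction expansion `R_n(t) = ∑_{i=1}^{s} ∑_{k=0}^{n} a_{i,k}/(t+k)^i`
> (2.3) … (1) As a rational function, the degree of `R_n(t)` is
> `deg R_n = 1 + (2r+1)|𝓕_B| n − (s+1)(n+1) ≤ −2`. This is due to `|𝓕_B| ≤ B²` and
> `s ≥ 10(2r+1)B²`. (2) The auxiliary function `R_n(t)` has the following symmetry: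
> `R_n(−t−n) = −R_n(t)`. In view of the fact that `(2r+1)n` is even and `s` is odd, the proof is
> a straightforward computation.»

In the parametrisation of `AuxiliaryFunction.lean` (`r = u/v`, `n = vm`, `(2r+1)n = (2u+v)m`,
`rn = um`) we PROVE (theorems only, no definitions, no named facts; sorry-free):

* `R_eq_eval_div` — `R_n(t) = Φ_n(t)/∏_{j=0}^{n}(t+j)^{s+1}` with the explicit numerator polynomial
  `Φ_n = C(κ₀) · (X − um) ∏_{θ ∈ 𝓕_B} ∏_{j<(2u+v)m} (X − um + j + θ) ∈ ℚ[X]`;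
* `natDegree_numerator_le` — **(1)**: `deg Φ_n ≤ 1 + (2r+1) n |𝓕_B|`;
* `R_reflect` — **(2)**: `R_n(−t−n) = −R_n(t)` (`(2r+1)n` even, `s` odd, `B ≥ 1`), from
  `ZeroSetSymmetry.numerator_reflect` / `denominator_reflect`;
* `exists_partialFraction` — the expansion (2.3) with poles of order `≤ s+1` at `0, −1, …, −n`
  exists as soon as `deg Φ_n < (s+1)(n+1)` (tree: `Transcendental.exists_pfEval_eq_eval_mul_prod_inv`);
  the vanishing of the order-`s+1` coefficients and of `∑_k a_{1,k}` (from `deg R_n ≤ −2`) are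
  not needed here and left to the file on Lemma 2.5.

## References

* [LaiYu2020] L. Lai, P. Yu, Compositio Math. 156 (2020) 1699–1717, §2, (2.3) and properties
  (1), (2) after Def. 2.3.
-/

noncomputable section

open Finset Polynomial

namespace Literature.NumberTheory.Irrationality.LaiYu2020

/-! ### `R_n = Φ_n / ∏ (t+j)^{s+1}` with an explicit numerator polynomial -/

/-- **`R_n(t) = Φ_n(t) / ∏_{j=0}^{n} (t+j)^{s+1}`** with
`Φ_n = C(A₁ⁿA₂ⁿ n!^{s+1}/m!^{(2u+v)|𝓕_B|}) · (X − um) ∏_{θ} ∏_{j<(2u+v)m} (X − um + j + θ)`.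
[cite: LaiYu2020, §2 Def. 2.3] -/
theorem R_eq_eval_div (u v s : ℕ) (B : ℝ) (m : ℕ) (t : ℚ) :
    R u v s B m t =
      (C ((A₁pow u v B m : ℚ) * (A₂pow u v B m : ℚ) * ((v * m).factorial : ℚ) ^ (s + 1) /
            ((m.factorial : ℚ) ^ ((2 * u + v) * (zeroSet_finite B).toFinset.card))) *
          ((X - C ((u : ℚ) * m)) * ∏ θ ∈ (zeroSet_finite B).toFinset,
            ∏ j ∈ range ((2 * u + v) * m), (X - C ((u : ℚ) * m) + C (j : ℚ) + C θ))).eval t /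
        (∏ j ∈ range (v * m + 1), (t + j)) ^ (s + 1) := by
  rw [R]
  simp only [eval_mul, eval_C, eval_sub, eval_add, eval_X, eval_prod]

/-- **Property (1)**: `deg Φ_n ≤ 1 + (2r+1) n |𝓕_B|` (so
`deg R_n = deg Φ_n − (s+1)(n+1) ≤ 1 + (2r+1)|𝓕_B| n − (s+1)(n+1)`).
[cite: LaiYu2020, §2 property (1) after Def. 2.3] -/
theorem natDegree_numerator_le (u v s : ℕ) (B : ℝ) (m : ℕ) :
    (C ((A₁pow u v B m : ℚ) * (A₂pow u v B m : ℚ) * ((v * m).factorial : ℚ) ^ (s + 1) /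
            ((m.factorial : ℚ) ^ ((2 * u + v) * (zeroSet_finite B).toFinset.card))) *
          ((X - C ((u : ℚ) * m)) * ∏ θ ∈ (zeroSet_finite B).toFinset,
            ∏ j ∈ range ((2 * u + v) * m), (X - C ((u : ℚ) * m) + C (j : ℚ) + C θ))).natDegree ≤
      1 + (2 * u + v) * m * (zeroSet_finite B).toFinset.card := by
  refine (natDegree_C_mul_le _ _).trans ?_
  refine natDegree_mul_le.trans ?_
  have h1 : (X - C ((u : ℚ) * m)).natDegree ≤ 1 := natDegree_X_sub_C_le _
  have h2 : (∏ θ ∈ (zeroSet_finite B).toFinset, ∏ j ∈ range ((2 * u + v) * m),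
      (X - C ((u : ℚ) * m) + C (j : ℚ) + C θ)).natDegree ≤
        (2 * u + v) * m * (zeroSet_finite B).toFinset.card := by
    refine (natDegree_prod_le _ _).trans ?_
    have h3 : ∀ θ ∈ (zeroSet_finite B).toFinset, (∏ j ∈ range ((2 * u + v) * m),
        (X - C ((u : ℚ) * m) + C (j : ℚ) + C θ)).natDegree ≤ (2 * u + v) * m := by
      intro θ _
      refine (natDegree_prod_le _ _).trans ?_
      have h4 : ∀ j ∈ range ((2 * u + v) * m),
          (X - C ((u : ℚ) * m) + C (j : ℚ) + C θ).natDegree ≤ 1 := by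
        intro j _
        have e : (X - C ((u : ℚ) * m) + C (j : ℚ) + C θ : ℚ[X]) = X + C (-((u : ℚ) * m) + j + θ) := by
          simp only [map_add, map_neg]
          ring
        rw [e]
        exact (natDegree_X_add_C _).le
      refine (sum_le_sum h4).trans ?_
      rw [sum_const, card_range, smul_eq_mul, mul_one]
    refine (sum_le_sum h3).trans ?_
    rw [sum_const, smul_eq_mul, mul_comm]
  omega

/-! ### Property (2): the reflection symmetry -/

/-- **Property (2)**: `R_n(−t−n) = −R_n(t)` whenever `(2r+1)n = (2u+v)m` is even (equivalently
`n = vm` is even), `s` is odd and `B ≥ 1` (and `(2r+1)n ≥ 1`).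
[cite: LaiYu2020, §2 property (2) after Def. 2.3] -/
theorem R_reflect {u v s : ℕ} {B : ℝ} {m : ℕ} (hB : 1 ≤ B) (hs : Odd s) (hn : Even (v * m))
    (hM : 1 ≤ (2 * u + v) * m) (t : ℚ) :
    R u v s B m (-t - (v : ℚ) * m) = -R u v s B m t := by
  obtain ⟨hF, hsymm, h1⟩ := zeroSet_reflect_hyps hB (zeroSet_finite B).toFinset
    (fun θ => (zeroSet_finite B).mem_toFinset)
  have hnum := numerator_reflect (zeroSet_finite B).toFinset hF hsymm h1 ((u : ℚ) * m) hM t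
  have hden := denominator_reflect (v * m) t
  -- `M - 2c = n`
  have e1 : (((2 * u + v) * m : ℕ) : ℚ) - 2 * ((u : ℚ) * m) = (v : ℚ) * m := by push_cast; ring
  rw [e1] at hnum
  have e2 : (((v * m : ℕ) : ℚ)) = (v : ℚ) * m := by push_cast; ring
  rw [e2] at hden
  -- signs
  have hMeven : Even ((2 * u + v) * m) := by
    have : (2 * u + v) * m = 2 * (u * m) + v * m := by ring
    rw [this]
    exact (even_two_mul _).add hn
  have hsign1 : ((-1 : ℚ)) ^ (1 + (2 * u + v) * m * (zeroSet_finite B).toFinset.card) = -1 := by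
    rw [pow_add, pow_one, (hMeven.mul_right _).neg_one_pow, mul_one]
  have hsign2 : (((-1 : ℚ)) ^ (v * m + 1)) ^ (s + 1) = 1 := by
    rw [← pow_mul]
    exact (hs.add_one.mul_left _).neg_one_pow
  rw [hsign1] at hnum
  unfold R
  rw [hden, mul_pow, hsign2, one_mul]
  -- the numerators
  have hnum' : (-t - (v : ℚ) * m - (u : ℚ) * m) * ∏ θ ∈ (zeroSet_finite B).toFinset,
      ∏ j ∈ range ((2 * u + v) * m), (-t - (v : ℚ) * m - (u : ℚ) * m + j + θ) =
        -1 * ((t - (u : ℚ) * m) * ∏ θ ∈ (zeroSet_finite B).toFinset,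
          ∏ j ∈ range ((2 * u + v) * m), (t - (u : ℚ) * m + j + θ)) := hnum
  rw [hnum']
  ring

/-! ### The partial-fraction expansion (2.3) -/

/-- `(∏_j (t+j))^{-(s+1)}` as the product over the list of shifts repeated `s+1` times. [folklore] -/
private theorem prod_shifts_eq (n s : ℕ) (t : ℚ) :
    (((range (s + 1)).toList.flatMap fun _ => (range (n + 1)).toList).map
        fun i : ℕ => (t + (i : ℚ))⁻¹).prod =
      ((∏ j ∈ range (n + 1), (t + j)) ^ (s + 1))⁻¹ := by
  rw [List.map_flatMap, List.flatMap_def, List.prod_flatten, List.map_map]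
  have hc : (List.prod ∘ fun _ : ℕ => ((range (n + 1)).toList.map fun i : ℕ => (t + (i : ℚ))⁻¹)) =
      fun _ => (∏ j ∈ range (n + 1), (t + (j : ℚ)))⁻¹ := by
    funext x
    simp only [Function.comp_apply]
    rw [Finset.prod_map_toList, prod_inv_distrib]
  rw [hc, List.map_const', List.prod_replicate, Finset.length_toList, card_range, inv_pow]

/-- **The partial-fraction expansion (2.3) of `R_n`** (existence): if `deg Φ_n < (s+1)(n+1)` there are
rationals `a_{i,k}` (`1 ≤ i ≤ s+1`, `0 ≤ k ≤ n`) with `R_n(t) = ∑_k ∑_i a_{i,k}/(t+k)^i` off the poles.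
[cite: LaiYu2020, §2 eq. (2.3)] -/
theorem exists_partialFraction (u v s : ℕ) (B : ℝ) (m : ℕ)
    (hdeg : 1 + (2 * u + v) * m * (zeroSet_finite B).toFinset.card < (s + 1) * (v * m + 1)) :
    ∃ a : ℕ → ℕ → ℚ, ∀ t : ℚ, (∀ j ∈ range (v * m + 1), t + j ≠ 0) →
      R u v s B m t = ∑ k ∈ range (v * m + 1), ∑ i ∈ Icc 1 (s + 1), a i k / (t + k) ^ i := by
  classical
  set n := v * m with hn
  set Φ : ℚ[X] := C ((A₁pow u v B m : ℚ) * (A₂pow u v B m : ℚ) * ((v * m).factorial : ℚ) ^ (s + 1) /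
      ((m.factorial : ℚ) ^ ((2 * u + v) * (zeroSet_finite B).toFinset.card))) *
    ((X - C ((u : ℚ) * m)) * ∏ θ ∈ (zeroSet_finite B).toFinset,
      ∏ j ∈ range ((2 * u + v) * m), (X - C ((u : ℚ) * m) + C (j : ℚ) + C θ)) with hΦ
  set L : List ℕ := (range (s + 1)).toList.flatMap fun _ => (range (n + 1)).toList with hL
  have hLmem : ∀ i ∈ L, i ∈ range (n + 1) := by
    intro i hi
    rw [hL, List.mem_flatMap] at hi
    obtain ⟨_, _, hi⟩ := hi
    exact Finset.mem_toList.1 hi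
  have hLlen : L.length = (s + 1) * (n + 1) := by
    rw [hL, List.length_flatMap]
    simp [Finset.length_toList]
  have hLcount : ∀ i ∈ range (n + 1), L.count i ≤ s + 1 := by
    intro i _
    rw [hL, List.count_flatMap]
    have h1 : ∀ x ∈ (range (s + 1)).toList.map (List.count i ∘ fun _ => (range (n + 1)).toList),
        x ≤ 1 := by
      intro x hx
      rw [List.mem_map] at hx
      obtain ⟨w, _, rfl⟩ := hx
      exact List.nodup_iff_count_le_one.1 (Finset.nodup_toList _) i
    refine (List.sum_le_card_nsmul _ 1 h1).trans ?_
    simp [Finset.length_toList]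
  have hdeg' : Φ.natDegree < L.length := by
    rw [hLlen]
    exact lt_of_le_of_lt (natDegree_numerator_le u v s B m) hdeg
  obtain ⟨c, hc⟩ := Transcendental.exists_pfEval_eq_eval_mul_prod_inv (range (n + 1)) Φ L hLmem hdeg'
  have hPF : Transcendental.IsPF (range (n + 1)) (fun i => L.count i) (R u v s B m) := by
    refine ⟨c, fun t ht => ?_⟩
    rw [← hc t ht, hL, prod_shifts_eq, R_eq_eval_div, div_eq_mul_inv]
  obtain ⟨c', hc'⟩ := hPF.mono hLcount
  refine ⟨fun i k => c' k i, fun t ht => ?_⟩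
  rw [hc' t ht, Transcendental.pfEval]
  refine sum_congr rfl fun k _ => sum_congr rfl fun i _ => ?_
  rw [div_eq_mul_inv]

/-! ### The standing hypotheses give `deg R_n ≤ −2` -/

/-- **Property (1) from the standing hypotheses**: if `|𝓕_B| ≤ B²` (Prop. 2.2 (3)) and
`s ≥ 10(2r+1)B²`, then `deg Φ_n + 2 ≤ 1 + (2r+1)n|𝓕_B| + 2 ≤ (s+1)(n+1)`, i.e. `deg R_n ≤ −2` — the
degree hypothesis of `exists_partialFraction`, `LinearFormsProofs.lemma25` and `abs_R_le`.
[cite: LaiYu2020, §2 property (1) ("This is due to |𝓕_B| ≤ B² and s ≥ 10(2r+1)B²")] -/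
theorem degree_condition {u v s : ℕ} {B : ℝ} {m : ℕ} (hv : 0 < v) (hB : 1 ≤ B)
    (hF : ((zeroSet_finite B).toFinset.card : ℝ) ≤ B ^ 2)
    (hs : 10 * (2 * ((u : ℝ) / v) + 1) * B ^ 2 ≤ s) :
    1 + (2 * u + v) * m * (zeroSet_finite B).toFinset.card + 2 ≤ (s + 1) * (v * m + 1) := by
  have hv' : (0 : ℝ) < v := by exact_mod_cast hv
  -- `(2u+v) m |𝓕| ≤ (2u+v) m B² = v m (2r+1) B² ≤ v m s / 10`
  have h1 : ((2 * u + v) * m * (zeroSet_finite B).toFinset.card : ℝ) ≤ (v * m : ℝ) * s / 10 := by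
    have hF0 : (0 : ℝ) ≤ (zeroSet_finite B).toFinset.card := Nat.cast_nonneg _
    have e : (2 * ((u : ℝ) / v) + 1) = (2 * u + v) / v := by field_simp
    rw [e] at hs
    have hs' : 10 * (2 * (u : ℝ) + v) * B ^ 2 ≤ v * s := by
      have := mul_le_mul_of_nonneg_left hs hv'.le
      rw [show (v : ℝ) * (10 * ((2 * u + v) / v) * B ^ 2) = 10 * (2 * (u : ℝ) + v) * B ^ 2 by
        field_simp] at this
      exact this
    have hm0 : (0 : ℝ) ≤ m := Nat.cast_nonneg _
    calc ((2 * u + v) * m * (zeroSet_finite B).toFinset.card : ℝ)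
        ≤ (2 * u + v) * m * B ^ 2 := mul_le_mul_of_nonneg_left hF (by positivity)
      _ = m * ((2 * (u : ℝ) + v) * B ^ 2) := by ring
      _ ≤ m * (v * s / 10) := mul_le_mul_of_nonneg_left (by linarith) hm0
      _ = (v * m : ℝ) * s / 10 := by ring
  -- `s ≥ 10 (2r+1) B² ≥ 10`
  have hs10 : (10 : ℝ) ≤ s := by
    have hr : (1 : ℝ) ≤ 2 * ((u : ℝ) / v) + 1 := by
      have : (0 : ℝ) ≤ (u : ℝ) / v := by positivity
      linarith
    have hB2 : (1 : ℝ) ≤ B ^ 2 := by nlinarith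
    nlinarith
  have h2 : (1 : ℝ) + (2 * u + v) * m * (zeroSet_finite B).toFinset.card + 2 ≤ (s + 1) * (v * m + 1) := by
    have hvm : (0 : ℝ) ≤ v * m := by positivity
    have hprod : (0 : ℝ) ≤ s * (v * m) := by positivity
    nlinarith [h1, hvm, hprod, hs10]
  exact_mod_cast h2

end Literature.NumberTheory.Irrationality.LaiYu2020

end
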